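import Literature.AlgebraicGeometry.Deformation.RelativeCurvilinearLiftingNotSmooth
import Literature.AlgebraicGeometry.Deformation.SmallExtensionFactorization
import HarnessLib

/-!
# [FM98] Example 5.7 (ii) fails already along a SMALL extension

Family `hodge` (computation cell `pub-hsemireg`, LIT-W seat «Pridham / derived deformation theory as printed»), layer
`Literature/AlgebraicGeometry/Deformation`; a two-file corollary linking
`RelativeCurvilinearLiftingNotSmooth.lean` (seat lit-w-kawamata-ran: [FantechiManetti1998ObstructionCalculus,
Example 5.7 (ii) and the Remark p. 562] — the morphism `h_R → h_S`, `R = k[x, y]/(x³, y³, x²y²)`, `S = k[x, y]/(x³, y³)`,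
has no relative curvilinear obstructions and yet is NOT smooth: `FM98Example57.not_smooth` exhibits a SURJECTION
`q : B ↠ A` of `Art_k` and a compatible pair with no common lift) with `SmallExtensionFactorization.lean`
([Schlessinger1968, Remarks (2.3), p. 210] = [StacksProject, Tag 06HH]: a morphism of functors of Artin rings that has
the lifting property along every SMALL extension has it along every surjection, `ArtinFunctor.relLift_of_isSmallExtension`).

[FantechiManetti1998ObstructionCalculus, Def. 2.15, p. 548] states smoothness of a morphism `n : F → G` as the lifting
property `F(B) ↠ ñ(e) = F(A) ×_{G(A)} G(B)` (Def. 2.14) along ALL small extensions `e ∈ Smex`, i.e. (Def. 1.0 / 1.3,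
p. 545) `e : 0 → M → B → A → 0` with `𝔪_B M = 0`, `M` any finite `k`-vector space ("principal if `dim_k K(e) = 1`"), in
particular along the principal ones `0 → k → B → A → 0` = [Schlessinger1968, Def. 1.2, p. 209] ("`p` is a small
extension if kernel `p` is a nonzero principal ideal `(t)` such that `𝔪 t = (0)`"; `IsSmallExtension` of `T1Lifting.lean`);
[Schlessinger1968, Def. 2.2, p. 210] asks it along every surjection, and Remarks (2.3) (ibid.): "It is enough to check
surjectivity […] for small extensions `B → A`". Hence the printed «not necessarily smooth» (p. 562: «The above examples
show that a morphism in Gdt without relative curvilinear obstructions is not necessarily smooth, even in the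
prorepresentable case and algebraically closed ground field»; "prorepresentable": `h_R`, `h_S` are prorepresented by the
Artinian `R`, `S`, Def. 2.16 p. 548) holds in the strongest of these forms: SOME PRINCIPAL small extension `p : B → A` of
`Art_k` (surjective, nonzero principal kernel `(t)` with `𝔪_B · t = 0`) and a compatible pair
`(a ∈ h_R(A), b ∈ h_S(B))`, `p ∘ b = a ∘ π` — a point of `ñ(e)` — admit no `b' ∈ h_R(B)` over both
(`FM98Example57.exists_isSmallExtension_not_lift`); failure along a principal small extension defeats Def. 2.15,
[Schlessinger1968] Def. 2.2 and (2.3) alike. The small extension is obtained by contraposition and is not named (the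
printed example's own surjection `A_2[y]/(y³) ↠ k` has kernel `𝔪`, which is not small). Holds for every field `k`.
One theorem, no definition, no named fact.

## References

* [FantechiManetti1998ObstructionCalculus] B. Fantechi, M. Manetti, Obstruction calculus for functors of Artin rings, I,
  J. Algebra 202 (1998) 541–576: Def. 1.0 / 1.3 (small and principal small extensions, p. 545), Def. 2.14–2.16 (p. 548),
  Example 5.7 (ii) and the Remark following it (p. 562).
* [Schlessinger1968] M. Schlessinger, Functors of Artin rings, Trans. AMS 130 (1968) 208–222: Def. 1.2 (p. 209), Def. 2.2
  and Remarks (2.3) (p. 210).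
* [StacksProject] The Stacks Project, Tag 06HH (smoothness may be tested on small extensions).
-/

namespace Literature.AlgebraicGeometry.Deformation

universe u
variable (k : Type u) [Field k]

open MvPolynomial in
/-- **[FM98] Example 5.7 (ii) fails already along a SMALL extension.** For `R = k[x, y]/(x³, y³, x²y²)`,
`S = k[x, y]/(x³, y³)` and `π : S ↠ R`, there are a small extension `p : B → A` of `Art_k` ([Schlessinger1968, Def. 1.2,
p. 209] / `IsSmallExtension`: surjective, kernel a nonzero principal ideal killed by `𝔪_B`; = a PRINCIPAL small extension
of [FantechiManetti1998ObstructionCalculus, Def. 1.0]), a point `a ∈ h_R(A)` and a point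
`b ∈ h_S(B)` with `p ∘ b = a ∘ π`, such that NO `b' ∈ h_R(B)` satisfies `p ∘ b' = a` and `b' ∘ π = b` — i.e. the morphism
`h_R → h_S` («has no relative curvilinear obstructions», Example 5.7 (ii)) is not smooth in the sense of
[FantechiManetti1998ObstructionCalculus, Def. 2.15] (lifting along small extensions), the form equivalent to
[Schlessinger1968, Def. 2.2] by Remarks (2.3). Proof: if every compatible pair lifted along every small extension, then
by `ArtinFunctor.relLift_of_isSmallExtension` (= Remarks (2.3)) applied to `η = (− ∘ π) : h_R → h_S` every compatible
pair would lift along every surjection, contradicting `FM98Example57.not_smooth`.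
[cite: FantechiManetti1998ObstructionCalculus, Ex. 5.7 (ii) and Remark p. 562, Def. 2.15 p. 548]
[cite: Schlessinger1968, Def. 2.2 and Remarks (2.3), p. 210] -/
theorem FM98Example57.exists_isSmallExtension_not_lift :
    ∃ (B A : ArtAlg.{u} k) (p : B →ₐ[k] A), IsSmallExtension k p ∧
      ∃ (a : (MvPolynomial (Fin 2) k ⧸ Ideal.span {(X 0 : MvPolynomial (Fin 2) k) ^ 3, X 1 ^ 3,
            X 0 ^ 2 * X 1 ^ 2}) →ₐ[k] A)
        (b : (MvPolynomial (Fin 2) k ⧸ Ideal.span {(X 0 : MvPolynomial (Fin 2) k) ^ 3, X 1 ^ 3}) →ₐ[k] B),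
        p.comp b = a.comp (Ideal.Quotient.factorₐ k (FM98Example57.span_le k)) ∧
        ¬ ∃ b' : (MvPolynomial (Fin 2) k ⧸ Ideal.span {(X 0 : MvPolynomial (Fin 2) k) ^ 3, X 1 ^ 3,
            X 0 ^ 2 * X 1 ^ 2}) →ₐ[k] B,
          p.comp b' = a ∧ b'.comp (Ideal.Quotient.factorₐ k (FM98Example57.span_le k)) = b := by
  by_contra hcon
  push Not at hcon
  -- `hcon`: along every small extension every compatible pair lifts; upgrade to all surjections by Remarks (2.3)
  have key := ArtinFunctor.relLift_of_isSmallExtension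
    (ArtinFunctor.points (k := k) (MvPolynomial (Fin 2) k ⧸ Ideal.span {(X 0 : MvPolynomial (Fin 2) k) ^ 3, X 1 ^ 3,
      X 0 ^ 2 * X 1 ^ 2}))
    (ArtinFunctor.points (k := k) (MvPolynomial (Fin 2) k ⧸ Ideal.span {(X 0 : MvPolynomial (Fin 2) k) ^ 3, X 1 ^ 3}))
    (fun T f => f.comp (Ideal.Quotient.factorₐ k (FM98Example57.span_le k))) (fun T T' φ f => rfl)
    (fun B' A' p hp y z hyz => by
      obtain ⟨b', h1, h2⟩ := hcon B' A' p hp y z hyz.symm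
      exact ⟨b', h1, h2⟩)
  obtain ⟨B, A, q, hq, a, b, hab, hno⟩ := FM98Example57.not_smooth k
  obtain ⟨x, hx1, hx2⟩ := key q hq a b hab.symm
  exact hno ⟨x, hx1, hx2⟩

end Literature.AlgebraicGeometry.Deformation
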